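import Mathlib
import HarnessLib
import Summits.ResolutionOfSingularities.ResolutionOfSingularities.Theorems.RadicialJungCleanModelsLens5GradedBasis
import Summits.ResolutionOfSingularities.ResolutionOfSingularities.Theorems.RadicialJungCleanModelsLens5ImmediateValuesCore

/-!
# Route `RadicialJung`, crux `CleanModels` (stmt-15917) — lens 5, THEOREM T step (V): degree lemmas

Port of `Cruxes/DescentPerfectToAll/Lens5_ImmediateValues.lean` (res-B-lens-5 g9 support workfile), Part 2.
OURS · counted 0. Nothing here proves resolution in characteristic `p`.

This file contains section `Degree`: `[K^p(g_0) : K^p] = p` for `g_0 notin K^p`, and `[K : K^p(g_0)] = p^2`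
under the named fact `[K : K^p] = p^3`.
-/

noncomputable section

set_option linter.dupNamespace false

open Module Polynomial IntermediateField
open Summit.ResolutionOfSingularities.ResolutionOfSingularities.Theorems.RadicialJung.CleanModels.Lens5.GradedBasis
open Summit.ResolutionOfSingularities.ResolutionOfSingularities.Theorems.RadicialJung.CleanModels.Lens5.ImmediateValues

namespace Summit.ResolutionOfSingularities.ResolutionOfSingularities.Theorems.RadicialJung.CleanModels.Lens5.ImmediateValues

variable {K : Type} [Field K] {Γ₀ : Type} [LinearOrderedCommGroupWithZero Γ₀]
variable {p : ℕ} [hp : Fact p.Prime] [CharP K p]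

/-- `X^p − g₀^p` is irreducible over `K^p` when `g₀ ∉ K^p`. [folklore] -/
theorem irreducible_X_pow_sub_C_pthPower (g₀ : K) (hg₀ : ∀ c : K, c ^ p ≠ g₀) :
    Irreducible (X ^ p - C (⟨g₀ ^ p, pow_mem_fieldRange_frobenius g₀⟩ : (frobenius K p).fieldRange)) := by
  refine X_pow_sub_C_irreducible_of_prime hp.out fun b hb => ?_
  obtain ⟨β, hβ⟩ := exists_pow_eq_of_mem_fieldRange_frobenius (p := p) b.2
  have hbK : (b : K) ^ p = g₀ ^ p := by have h := congrArg Subtype.val hb; simpa using h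
  have h0 : ((b : K) - g₀) ^ p = 0 := by rw [sub_pow_char, hbK, sub_self]
  have hbg : (b : K) = g₀ := sub_eq_zero.mp ((pow_eq_zero_iff hp.out.ne_zero).mp h0)
  exact hg₀ β (by rw [hβ, hbg])

/-- Evaluation of `X^p - g₀^p` at `g₀` is zero. [folklore] -/
theorem aeval_X_pow_sub_C_pthPower (g₀ : K) :
    aeval g₀ (X ^ p - C (⟨g₀ ^ p, pow_mem_fieldRange_frobenius g₀⟩ : (frobenius K p).fieldRange)) = 0 := by
  rw [map_sub, aeval_X_pow, aeval_C]; exact sub_self _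

/-- `g₀` is integral over `K^p`. [folklore] -/
theorem isIntegral_fieldRange_frobenius (g₀ : K) : IsIntegral (frobenius K p).fieldRange g₀ :=
  ⟨_, monic_X_pow_sub_C _ hp.out.ne_zero, by have h := aeval_X_pow_sub_C_pthPower (p := p) g₀; rwa [aeval_def] at h⟩

/-- The minimal polynomial of `g₀ ∉ K^p` over `K^p` is `X^p − g₀^p`. [folklore] -/
theorem minpoly_eq_X_pow_sub_C (g₀ : K) (hg₀ : ∀ c : K, c ^ p ≠ g₀) :
    minpoly (frobenius K p).fieldRange g₀ = X ^ p - C (⟨g₀ ^ p, pow_mem_fieldRange_frobenius g₀⟩ : (frobenius K p).fieldRange) :=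
  (minpoly.eq_of_irreducible_of_monic (irreducible_X_pow_sub_C_pthPower g₀ hg₀) (aeval_X_pow_sub_C_pthPower g₀)
    (monic_X_pow_sub_C _ hp.out.ne_zero)).symm

/-- `[K^p(g₀) : K^p] = p` for `g₀ ∉ K^p`. [folklore] -/
theorem finrank_adjoin_pthPowers_eq (g₀ : K) (hg₀ : ∀ c : K, c ^ p ≠ g₀) :
    finrank (frobenius K p).fieldRange (frobenius K p).fieldRange⟮g₀⟯ = p := by
  rw [adjoin.finrank (isIntegral_fieldRange_frobenius g₀), minpoly_eq_X_pow_sub_C g₀ hg₀, natDegree_X_pow_sub_C]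

/-- `[K : K^p(g₀)] = p²` for `g₀ ∉ K^p`, GIVEN the p-degree `[K : K^p] = p³` (named fact `hdeg`). [folklore] -/
theorem finrank_over_adjoin_pthPowers_eq (g₀ : K) (hg₀ : ∀ c : K, c ^ p ≠ g₀)
    (hdeg : finrank (frobenius K p).fieldRange K = p ^ 3) :
    finrank (frobenius K p).fieldRange⟮g₀⟯ K = p ^ 2 := by
  have htower := Module.finrank_mul_finrank (frobenius K p).fieldRange (frobenius K p).fieldRange⟮g₀⟯ K
  rw [finrank_adjoin_pthPowers_eq g₀ hg₀, hdeg] at htower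
  have h : p * finrank (frobenius K p).fieldRange⟮g₀⟯ K = p * p ^ 2 := by rw [htower]; ring
  exact Nat.eq_of_mul_eq_mul_left hp.out.pos h

/-- Membership in `K^p(g₀)` in the currency of the stub. [folklore] -/
theorem mem_adjoin_pthPowers_iff (g₀ x : K) :
    x ∈ (frobenius K p).fieldRange⟮g₀⟯ ↔ ∃ c : Fin p → K, ∑ j, c j ^ p * g₀ ^ (j : ℕ) = x := by
  have hint := isIntegral_fieldRange_frobenius (p := p) g₀
  constructor
  · intro hx
    have hx' : x ∈ ((frobenius K p).fieldRange⟮g₀⟯).toSubalgebra := hx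
    rw [adjoin_simple_toSubalgebra_of_isAlgebraic hint.isAlgebraic, Algebra.adjoin_singleton_eq_range_aeval] at hx'
    obtain ⟨q, rfl⟩ := hx'
    set r := q %ₘ minpoly (frobenius K p).fieldRange g₀ with hr_def
    have hqr : aeval g₀ r = aeval g₀ q := aeval_modByMonic_eq_self_of_root (minpoly.aeval _ g₀)
    have hdeg_min : (minpoly (frobenius K p).fieldRange g₀).natDegree ≤ p := by
      have hdvd := minpoly.dvd (frobenius K p).fieldRange g₀ (aeval_X_pow_sub_C_pthPower g₀)
      have hne : (X ^ p - C (⟨g₀ ^ p, pow_mem_fieldRange_frobenius g₀⟩ : (frobenius K p).fieldRange)) ≠ 0 :=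
        (monic_X_pow_sub_C _ hp.out.ne_zero).ne_zero
      have h := natDegree_le_of_dvd hdvd hne
      rwa [natDegree_X_pow_sub_C] at h
    have hr_lt : r.natDegree < p :=
      lt_of_lt_of_le (natDegree_modByMonic_lt q (minpoly.monic hint) (minpoly.ne_one _ g₀)) hdeg_min
    change ∃ c : Fin p → K, ∑ j, c j ^ p * g₀ ^ (j : ℕ) = aeval g₀ q
    rw [← hqr, aeval_eq_sum_range' hr_lt, Finset.sum_range]
    choose α hα using fun i : Fin p => exists_pow_eq_of_mem_fieldRange_frobenius (p := p) (r.coeff i).2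
    exact ⟨α, Finset.sum_congr rfl fun i _ => by rw [hα, Subfield.smul_def, smul_eq_mul]⟩
  · rintro ⟨c, rfl⟩
    refine sum_mem fun j _ => mul_mem ?_ (pow_mem (mem_adjoin_simple_self _ g₀) _)
    have : c j ^ p = algebraMap (frobenius K p).fieldRange K ⟨c j ^ p, pow_mem_fieldRange_frobenius (c j)⟩ := rfl
    rw [this]; exact IntermediateField.algebraMap_mem _ _

/-- **`[K : K^p(g₀)] = p²`, packaged def-free** (given p-degree `hdeg`). [folklore] -/
theorem exists_subfield_pthPowers_adjoin_finrank (g₀ : K) (hg₀ : ∀ c : K, c ^ p ≠ g₀)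
    (hdeg : finrank (frobenius K p).fieldRange K = p ^ 3) :
    ∃ M : Subfield K, (∀ x : K, x ∈ M ↔ ∃ c : Fin p → K, ∑ j, c j ^ p * g₀ ^ (j : ℕ) = x) ∧ finrank M K = p ^ 2 :=
  ⟨((frobenius K p).fieldRange⟮g₀⟯).toSubfield, fun x => mem_adjoin_pthPowers_iff g₀ x,
    finrank_over_adjoin_pthPowers_eq g₀ hg₀ hdeg⟩

/-- Glue: over a subfield `M` with `finrank M K = N`, a linearly independent family of `N` elements represents
every element of `K`. [folklore] -/
theorem exists_repr_of_linearIndependent_card_eq (M : Subfield K) {N : ℕ} (hN : finrank M K = N) (hN0 : 0 < N)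
    {ι : Type} [Fintype ι] (b : ι → K) (hb : LinearIndependent M b) (hcard : Fintype.card ι = N) (x : K) :
    ∃ a : ι → M, ∑ i, a i • b i = x := by
  haveI : Module.Finite M K := Module.finite_of_finrank_pos (by rw [hN]; exact hN0)
  haveI : Nonempty ι := Fintype.card_pos_iff.mp (by rw [hcard]; exact hN0)
  have hspan : Submodule.span M (Set.range b) = ⊤ := hb.span_eq_top_of_card_eq_finrank (by rw [hcard, hN])
  have hx : x ∈ Submodule.span M (Set.range b) := by rw [hspan]; exact Submodule.mem_top
  exact (Submodule.mem_span_range_iff_exists_fun M).mp hx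

end Summit.ResolutionOfSingularities.ResolutionOfSingularities.Theorems.RadicialJung.CleanModels.Lens5.ImmediateValues

end
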